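import Literature.Barriers.CriticalPhenomena.MassTransportPrincipleQuasiTransitive
import HarnessLib

/-!
# Timár 2006, §2: levels, "above/below", weights, heavy and light clusters, and the
# nonunimodular Mass-Transport Principle (Lemma 2.2) — PROVED

Barrier catalogue `Literature/Barriers/CriticalPhenomena/`; first brick of the programme behind
the named fact `Timar2006_atMostOneCriticalCluster` (`SubexponentialGrowthZdUniqueness.lean`:
"Let `G` be a nonunimodular, quasi-transitive graph. Then `G[p_c]` has at most one infinite
cluster almost surely", Hutchcroft's 2016 quotation of Á. Timár, *Percolation on nonunimodular
transitive graphs*, Ann. Probab. 34 (2006) 2344–2364, Cor. 5.7). This file formalises the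
terminology of Timár's §2 ("Terminology and notation; the MTP", pp. 2346–2348) on top of the
tree's stabiliser orbits `S(x)y` (`stabilizerOrbit`), unimodularity (`IsGraphUnimodular`) and the
weights `μ_x = |S(x)o|/|S(o)x|` of Lyons–Peres 2016, Thm. 8.10 (`autWeight`, which is literally
Timár's "`w(o) := 1` … `w(x) := |S_x o|/|S_o x|`"), all for the FULL automorphism group of a
connected, locally finite graph. Everything here is PROVED:

* `SameLevel G x y :↔ |S(x)y| = |S(y)x|` and `IsAbove G x y :↔ |S(x)y| > |S(y)x|` ("We shall say
  that a vertex `x` is *above* vertex `y` if `|S_x y| > |S_y x|`"); `sameLevel_iff_autWeight_eq`,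
  `isAbove_iff_autWeight_lt` ("It is easy to show that for any `x, y ∈ G`,
  `|S_x y|/|S_y x| = w(x)/w(y)`. Hence, two vertices are on the same level if and only if their
  weights are the same"); `SameLevel` is an equivalence relation (`sameLevel_trans`, via the
  cocycle identity, Lyons–Peres (8.9)), and `level G x`, its class, is the unique maximal set
  through `x` on which `|S_x y| = |S_y x|` pairwise (`level_maximal`) — Timár's definition "A
  *level* of a nonunimodular graph is a maximal set `X` of vertices such that for any
  `x, y ∈ X`, `|S_x y| = |S_y x|`";
* invariance: automorphisms map `S(x)y` onto `S(γx)(γy)` (`image_stabilizerOrbit`), preserve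
  `SameLevel`/`IsAbove`/levels, and multiply all weights by one constant
  (`autWeight_map_mul`: "any automorphism of `G` acts on the weights of the levels by multiplying
  them with a constant", Timár §5);
* unimodularity: `IsGraphUnimodular G ↔` vertices in a common orbit are on the same level
  (`isGraphUnimodular_iff_sameLevel`, Lyons–Peres: "`Γ` is unimodular iff `μ_y = μ_x` whenever
  `y ∈ Γx`"); on a connected graph, nonunimodularity forces an EDGE between different levels
  (`exists_adj_isAbove_of_not_isGraphUnimodular`, the content of Lyons–Peres Exercise 8.6:
  "if `Γ` acts transitively, then `Γ` is unimodular iff `|S(x)y| = |S(y)x|` for all edges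
  `[x, y]`"), and on a transitive nonunimodular graph every vertex has a neighbour above it and a
  neighbour below it (`exists_neighbor_above`, `exists_neighbor_below`);
* **Lemma 2.2 (the nonunimodular MTP), PROVED** (`tsum_eq_inv_autWeight_mul_tsum`): "Let `G` be a
  transitive nonunimodular graph and `f(x, y)` a nonnegative function from `V(G) × V(G)` that is
  diagonally invariant under `Aut(G)`. Then `Σ_y f(x,y) = w(x)⁻¹ Σ_y f(y,x) w(y)` for every vertex
  `x`" (from Lyons–Peres (8.10), `tsum_autOrbit_mul_autWeight_eq`; unimodularity is not needed,
  the identity holds on every connected locally finite transitive graph), with its form for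
  invariant random transports `E[Σ_y φ(x,y;ω)] = w(x)⁻¹ E[Σ_y φ(y,x;ω) w(y)]`
  (`lintegral_tsum_eq_inv_autWeight_mul`, "`x` sends mass `φ(x,y,ω)` to `y` when `ω`");
* heavy and light vertex sets (`setWeight`, `IsHeavy`: "We call a cluster *heavy* if the sum of
  weights over its vertices is infinite. Otherwise, we call the cluster *light*"), independence of
  the base vertex (`isHeavy_iff_of_base`), "light ⟹ only finitely many vertices of weight `≥ a`"
  (`finite_inter_of_not_isHeavy`, the fact behind "the intersection of a light cluster with
  `G(ℓ_{j+i}, ℓ_j]` is finite by definition", §4), and on a transitive unimodular graph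
  heavy = infinite (`isHeavy_iff_infinite_of_isGraphUnimodular`).

Not here (later bricks): separating sets of levels and slabs, the branching lemma 4.1, Thm. 4.3,
§5 (these are vendored as named facts in `TimarCriticalNonunimodular.lean`).

## References

* Á. Timár, *Percolation on nonunimodular transitive graphs*, Ann. Probab. 34 (2006) 2344–2364
  (arXiv:math/0702875), §2 (levels, weights, above/below, heavy/light, Lemma 2.2), §4 (p. 2353),
  §5 (first paragraph: "any automorphism … acts on the weights … by multiplying them with a
  constant"). [Timar2006]
* R. Lyons, Y. Peres, *Probability on Trees and Networks*, CUP 2016, §8.2: Thm. 8.10, (8.7),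
  (8.9), (8.10), the remark "`Γ` is unimodular iff `μ_y = μ_x` whenever `y ∈ Γx`", Exercise 8.6,
  Exercise 8.28. [LyonsPeres2016]
-/

noncomputable section

namespace Literature.Barriers.CriticalPhenomena

open scoped ENNReal

variable {V : Type*}

/-! ### Levels and the relation "above" (Timár 2006, §2) -/

/-- `x` and `y` are **on the same level**: `|S(x)y| = |S(y)x|` (Timár 2006, §2: "A *level* of a
nonunimodular graph is a maximal set `X` of vertices such that for any `x, y ∈ X`,
`|S_x y| = |S_y x|`"; the levels are the classes of this relation, `level`, `level_maximal`).
[cite: Timar2006, §2 (definition of a level)] -/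
def SameLevel (G : SimpleGraph V) (x y : V) : Prop :=
  (stabilizerOrbit G x y).encard = (stabilizerOrbit G y x).encard

/-- `x` is **above** `y` (and `y` is *below* `x`): `|S(x)y| > |S(y)x|` (Timár 2006, §2: "We shall
say that a vertex `x` is *above* vertex `y` if `|S_x y| > |S_y x|`. If `x` is above `y`, then `y`
is said to be *below* `x`"). [cite: Timar2006, §2 (definition of "above"/"below")] -/
def IsAbove (G : SimpleGraph V) (x y : V) : Prop :=
  (stabilizerOrbit G y x).encard < (stabilizerOrbit G x y).encard

/-- The **level** of `x`: the vertices on the same level as `x`.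
[cite: Timar2006, §2 (definition of a level)] -/
def level (G : SimpleGraph V) (x : V) : Set V := {y | SameLevel G x y}

/-- `SameLevel` is reflexive. [folklore] -/
theorem sameLevel_refl (G : SimpleGraph V) (x : V) : SameLevel G x x := rfl

/-- `SameLevel` is symmetric. [folklore] -/
theorem SameLevel.symm {G : SimpleGraph V} {x y : V} (h : SameLevel G x y) : SameLevel G y x :=
  Eq.symm h

/-- `SameLevel` is symmetric (iff form). [folklore] -/
theorem sameLevel_comm (G : SimpleGraph V) {x y : V} : SameLevel G x y ↔ SameLevel G y x :=
  ⟨SameLevel.symm, SameLevel.symm⟩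

/-- `x ∈ level x`. [folklore] -/
theorem mem_level_self (G : SimpleGraph V) (x : V) : x ∈ level G x := sameLevel_refl G x

/-- "Above" is irreflexive. [folklore] -/
theorem not_isAbove_self (G : SimpleGraph V) (x : V) : ¬ IsAbove G x x := lt_irrefl _

/-- "Above" is asymmetric. [folklore] -/
theorem IsAbove.not_isAbove_symm {G : SimpleGraph V} {x y : V} (h : IsAbove G x y) :
    ¬ IsAbove G y x :=
  lt_asymm h

/-- A vertex above another is not on its level. [folklore] -/
theorem IsAbove.not_sameLevel {G : SimpleGraph V} {x y : V} (h : IsAbove G x y) :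
    ¬ SameLevel G x y := by
  intro h'
  unfold IsAbove at h
  unfold SameLevel at h'
  rw [h'] at h
  exact lt_irrefl _ h

/-- Trichotomy: two vertices are on the same level, or one is above the other. [folklore] -/
theorem sameLevel_or_isAbove_or_isAbove (G : SimpleGraph V) (x y : V) :
    SameLevel G x y ∨ IsAbove G x y ∨ IsAbove G y x := by
  rcases lt_trichotomy (stabilizerOrbit G y x).encard (stabilizerOrbit G x y).encard with h | h | h
  · exact Or.inr (Or.inl h)
  · exact Or.inl h.symm
  · exact Or.inr (Or.inr h)

/-- Off the level of `y`, `x` is either above or below `y`. [folklore] -/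
theorem isAbove_or_isAbove_of_not_sameLevel {G : SimpleGraph V} {x y : V} (h : ¬ SameLevel G x y) :
    IsAbove G x y ∨ IsAbove G y x :=
  (sameLevel_or_isAbove_or_isAbove G x y).resolve_left h

/-! ### Levels and weights: `|S_x y| / |S_y x| = w(x) / w(y)` -/

/-- **"Two vertices are on the same level if and only if their weights are the same"** (Timár
2006, §2; Lyons–Peres 2016, (8.7): `μ_x/μ_y = |S(x)y|/|S(y)x|`), for the weights
`w = autWeight G o` based at any vertex `o` of a connected locally finite graph.
[cite: Timar2006, §2 ("two vertices are on the same level if and only if their weights are the same")]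
[cite: LyonsPeres2016, Thm. 8.10 ((8.7))] -/
theorem sameLevel_iff_autWeight_eq (G : SimpleGraph V) [G.LocallyFinite] (hconn : G.Connected)
    (o x y : V) : SameLevel G x y ↔ autWeight G o x = autWeight G o y := by
  have key := autWeight_mul_encard G hconn o x y
  have hx0 := autWeight_ne_zero G hconn o x
  have hxT := autWeight_ne_top G hconn o x
  have h0 := encard_stabilizerOrbit_ne_zero G x y
  have hT := encard_stabilizerOrbit_ne_top G hconn x y
  constructor
  · intro h
    have h' : ((stabilizerOrbit G y x).encard : ℝ≥0∞) = (stabilizerOrbit G x y).encard := by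
      rw [ENat.toENNReal_inj]; exact h.symm
    rw [h'] at key
    exact (ENNReal.mul_left_inj h0 hT).1 key
  · intro h
    rw [h] at key
    have h' := (ENNReal.mul_right_inj (h ▸ hx0) (h ▸ hxT)).1 key
    rw [ENat.toENNReal_inj] at h'
    exact h'.symm

/-- **`x` is above `y` iff `w(y) < w(x)`** ("`|S_x y|/|S_y x| = w(x)/w(y)`", Timár 2006, §2), for
the weights based at any `o` (connected, locally finite).
[cite: Timar2006, §2 (|S_x y|/|S_y x| = w(x)/w(y))] [cite: LyonsPeres2016, Thm. 8.10 ((8.7))] -/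
theorem isAbove_iff_autWeight_lt (G : SimpleGraph V) [G.LocallyFinite] (hconn : G.Connected)
    (o x y : V) : IsAbove G x y ↔ autWeight G o y < autWeight G o x := by
  -- `w(x) |S(y)x| = w(y) |S(x)y|` with all four factors in `(0, ∞)`
  have key := autWeight_mul_encard G hconn o x y
  have hx0 := autWeight_ne_zero G hconn o x
  have hxT := autWeight_ne_top G hconn o x
  have hy0 := autWeight_ne_zero G hconn o y
  have hyT := autWeight_ne_top G hconn o y
  have ha0 := encard_stabilizerOrbit_ne_zero G y x
  have haT := encard_stabilizerOrbit_ne_top G hconn y x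
  have hb0 := encard_stabilizerOrbit_ne_zero G x y
  have hbT := encard_stabilizerOrbit_ne_top G hconn x y
  rw [IsAbove, ← ENat.toENNReal_lt]
  constructor
  · intro hab
    by_contra hle
    rw [not_lt] at hle
    -- `w(x)|S(y)x| < w(x)|S(x)y| ≤ w(y)|S(x)y| = w(x)|S(y)x|`
    have h1 : autWeight G o x * ((stabilizerOrbit G y x).encard : ℝ≥0∞) <
        autWeight G o x * (stabilizerOrbit G x y).encard := ENNReal.mul_lt_mul_right hx0 hxT hab
    have h2 : autWeight G o x * ((stabilizerOrbit G x y).encard : ℝ≥0∞) ≤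
        autWeight G o y * (stabilizerOrbit G x y).encard :=
      (ENNReal.mul_le_mul_iff_left hb0 hbT).2 hle
    exact absurd key (ne_of_lt (lt_of_lt_of_le h1 h2))
  · intro hyx
    by_contra hle
    rw [not_lt] at hle
    -- `w(y)|S(x)y| < w(x)|S(x)y| ≤ w(x)|S(y)x| = w(y)|S(x)y|`
    have h1 : autWeight G o y * ((stabilizerOrbit G x y).encard : ℝ≥0∞) <
        autWeight G o x * (stabilizerOrbit G x y).encard := ENNReal.mul_lt_mul_left hb0 hbT hyx
    have h2 : autWeight G o x * ((stabilizerOrbit G x y).encard : ℝ≥0∞) ≤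
        autWeight G o x * (stabilizerOrbit G y x).encard :=
      (ENNReal.mul_le_mul_iff_right hx0 hxT).2 hle
    exact absurd key.symm (ne_of_lt (lt_of_lt_of_le h1 h2))

/-- `SameLevel` is transitive on a connected locally finite graph (the cocycle identity,
Lyons–Peres 2016, (8.9), through the weights). [cite: LyonsPeres2016, §8.2 ((8.9))] -/
theorem SameLevel.trans {G : SimpleGraph V} [G.LocallyFinite] (hconn : G.Connected) {x y z : V}
    (hxy : SameLevel G x y) (hyz : SameLevel G y z) : SameLevel G x z := by
  rw [sameLevel_iff_autWeight_eq G hconn x] at hxy hyz ⊢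
  exact hxy.trans hyz

/-- `SameLevel` is an equivalence relation on a connected locally finite graph. [folklore] -/
theorem sameLevel_equivalence (G : SimpleGraph V) [G.LocallyFinite] (hconn : G.Connected) :
    Equivalence (SameLevel G) :=
  ⟨sameLevel_refl G, SameLevel.symm, SameLevel.trans hconn⟩

/-- "Above" is transitive (connected, locally finite). [folklore] -/
theorem IsAbove.trans {G : SimpleGraph V} [G.LocallyFinite] (hconn : G.Connected) {x y z : V}
    (hxy : IsAbove G x y) (hyz : IsAbove G y z) : IsAbove G x z := by
  rw [isAbove_iff_autWeight_lt G hconn x] at hxy hyz ⊢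
  exact hyz.trans hxy

/-- Above a vertex of a level means above the whole level (connected, locally finite). [folklore] -/
theorem IsAbove.of_sameLevel_right {G : SimpleGraph V} [G.LocallyFinite] (hconn : G.Connected)
    {x y z : V} (hxy : IsAbove G x y) (hyz : SameLevel G y z) : IsAbove G x z := by
  rw [isAbove_iff_autWeight_lt G hconn x] at hxy ⊢
  rw [sameLevel_iff_autWeight_eq G hconn x] at hyz
  rwa [← hyz]

/-- Two vertices are on the same level iff their levels coincide (connected, locally finite).
[folklore] -/
theorem level_eq_level_iff (G : SimpleGraph V) [G.LocallyFinite] (hconn : G.Connected) {x y : V} :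
    level G x = level G y ↔ SameLevel G x y := by
  constructor
  · intro h
    have : y ∈ level G x := h ▸ mem_level_self G y
    exact this
  · intro h
    ext z
    exact ⟨fun hz => (h.symm).trans hconn hz, fun hz => h.trans hconn hz⟩

/-- **Levels are the maximal sets with `|S_x y| = |S_y x|` pairwise** (Timár's definition of a
level, 2006, §2): the level of `x` has the pairwise property, and every set through `x` with the
pairwise property lies inside it (connected, locally finite).
[cite: Timar2006, §2 (definition of a level)] -/
theorem level_maximal (G : SimpleGraph V) [G.LocallyFinite] (hconn : G.Connected) (x : V) :
    (∀ y ∈ level G x, ∀ z ∈ level G x, SameLevel G y z) ∧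
      ∀ X : Set V, x ∈ X → (∀ y ∈ X, ∀ z ∈ X, SameLevel G y z) → X ⊆ level G x :=
  ⟨fun _ hy _ hz => (SameLevel.symm hy).trans hconn hz, fun _ hx hX y hy => hX x hx y hy⟩

/-! ### Invariance under automorphisms -/

/-- Automorphisms transport stabiliser orbits: `γ (S(x) y) = S(γx)(γy)`. [folklore] -/
theorem image_stabilizerOrbit {G : SimpleGraph V} (γ : G ≃g G) (x y : V) :
    (γ : V → V) '' stabilizerOrbit G x y = stabilizerOrbit G (γ x) (γ y) := by
  ext z
  constructor
  · rintro ⟨w, ⟨δ, hδx, rfl⟩, rfl⟩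
    refine ⟨(γ.symm.trans δ).trans γ, ?_, ?_⟩
    · show γ (δ (γ.symm (γ x))) = γ x
      rw [γ.symm_apply_apply, hδx]
    · show γ (δ (γ.symm (γ y))) = γ (δ y)
      rw [γ.symm_apply_apply]
  · rintro ⟨δ, hδx, rfl⟩
    refine ⟨γ.symm (δ (γ y)), ⟨(γ.trans δ).trans γ.symm, ?_, rfl⟩, γ.apply_symm_apply _⟩
    show γ.symm (δ (γ x)) = x
    rw [hδx, γ.symm_apply_apply]

/-- `|S(γx)(γy)| = |S(x)y|`. [folklore] -/
theorem encard_stabilizerOrbit_map {G : SimpleGraph V} (γ : G ≃g G) (x y : V) :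
    (stabilizerOrbit G (γ x) (γ y)).encard = (stabilizerOrbit G x y).encard := by
  rw [← image_stabilizerOrbit γ x y, γ.injective.encard_image]

/-- Automorphisms preserve levels: `SameLevel (γx) (γy) ↔ SameLevel x y`. [folklore] -/
theorem sameLevel_map_iff {G : SimpleGraph V} (γ : G ≃g G) (x y : V) :
    SameLevel G (γ x) (γ y) ↔ SameLevel G x y := by
  rw [SameLevel, SameLevel, encard_stabilizerOrbit_map, encard_stabilizerOrbit_map]

/-- Automorphisms preserve "above": `IsAbove (γx) (γy) ↔ IsAbove x y`. [folklore] -/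
theorem isAbove_map_iff {G : SimpleGraph V} (γ : G ≃g G) (x y : V) :
    IsAbove G (γ x) (γ y) ↔ IsAbove G x y := by
  rw [IsAbove, IsAbove, encard_stabilizerOrbit_map, encard_stabilizerOrbit_map]

/-- Automorphisms map levels onto levels: `γ (level x) = level (γ x)`. [folklore] -/
theorem image_level {G : SimpleGraph V} (γ : G ≃g G) (x : V) :
    (γ : V → V) '' level G x = level G (γ x) := by
  ext z
  constructor
  · rintro ⟨y, hy, rfl⟩
    exact (sameLevel_map_iff γ x y).2 hy
  · intro hz
    refine ⟨γ.symm z, ?_, γ.apply_symm_apply z⟩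
    have := (sameLevel_map_iff γ x (γ.symm z)).1
    rw [γ.apply_symm_apply] at this
    exact this hz

/-- The weight based at `y` is the ratio of weights based at `o`: `w_y(x) · w_o(y) = w_o(x)`
("This definition is independent of the choice of `o` up to a constant factor", Timár 2006,
§2; Lyons–Peres 2016, proof of Thm. 8.10, uniqueness up to a constant multiple).
[cite: Timar2006, §2 (weights independent of o up to a constant factor)]
[cite: LyonsPeres2016, Thm. 8.10 (proof)] -/
theorem autWeight_base_mul (G : SimpleGraph V) [G.LocallyFinite] (hconn : G.Connected)
    (o y x : V) : autWeight G y x * autWeight G o y = autWeight G o x := by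
  -- `w_y(x) = |S(x)y|/|S(y)x| = w_o(x)/w_o(y)` by (8.7)
  have h : autWeight G y x = autWeight G o x / autWeight G o y :=
    encard_div_encard_eq_autWeight_div G hconn o x y
  rw [h, ENNReal.div_mul_cancel (autWeight_ne_zero G hconn o y) (autWeight_ne_top G hconn o y)]

/-- **Automorphisms multiply all weights by one constant** (Timár 2006, §5: "any automorphism
of `G` acts on the weights of the levels by multiplying them with a constant"):
`w(γx) · w(y) = w(γy) · w(x)`, i.e. `w(γx)/w(x)` does not depend on `x`.
[cite: Timar2006, §5 (automorphisms act on weights by a constant factor)] -/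
theorem autWeight_map_mul (G : SimpleGraph V) [G.LocallyFinite] (hconn : G.Connected)
    (γ : G ≃g G) (o x y : V) :
    autWeight G o (γ x) * autWeight G o y = autWeight G o (γ y) * autWeight G o x := by
  -- both sides equal `w(γy) w(y) · w_{y}(x)` resp. via `w_{γy}(γx) = w_y(x)`
  have h1 := autWeight_base_mul G hconn o y x            -- w_y(x) w(y) = w(x)
  have h2 := autWeight_base_mul G hconn o (γ y) (γ x)     -- w_{γy}(γx) w(γy) = w(γx)
  have hinv : autWeight G (γ y) (γ x) = autWeight G y x := by
    rw [autWeight, autWeight, encard_stabilizerOrbit_map, encard_stabilizerOrbit_map]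
  rw [← h1, ← h2, hinv]
  ring

/-! ### Unimodularity in terms of levels -/

/-- **Unimodular iff vertices in a common orbit are on a common level** (Lyons–Peres 2016, §8.2:
"Note that `Γ` is unimodular iff `μ_y = μ_x` whenever `y ∈ Γx`"; this is the definition of
`IsGraphUnimodular` read through `SameLevel`).
[cite: LyonsPeres2016, §8.2 (remark after the proof of Thm. 8.10)] -/
theorem isGraphUnimodular_iff_sameLevel (G : SimpleGraph V) :
    IsGraphUnimodular G ↔ ∀ x y : V, (∃ γ : G ≃g G, γ x = y) → SameLevel G x y :=
  Iff.rfl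

/-- On a nonunimodular graph some vertex is above a vertex of its own orbit. [folklore] -/
theorem exists_isAbove_of_not_isGraphUnimodular {G : SimpleGraph V} (hU : ¬ IsGraphUnimodular G) :
    ∃ x y : V, (∃ γ : G ≃g G, γ x = y) ∧ IsAbove G x y := by
  rw [isGraphUnimodular_iff_sameLevel] at hU
  push Not at hU
  obtain ⟨x, y, hxy, hne⟩ := hU
  rcases isAbove_or_isAbove_of_not_sameLevel hne with h | h
  · exact ⟨x, y, hxy, h⟩
  · obtain ⟨γ, rfl⟩ := hxy
    exact ⟨γ x, x, ⟨γ.symm, γ.symm_apply_apply x⟩, h⟩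

/-- Along a walk all of whose edges join vertices of a common level, the endpoints are on a
common level (connected, locally finite). [folklore] -/
theorem sameLevel_of_walk {G : SimpleGraph V} [G.LocallyFinite] (hconn : G.Connected)
    (h : ∀ x y : V, G.Adj x y → SameLevel G x y) :
    ∀ {x y : V} (_ : G.Walk x y), SameLevel G x y
  | _, _, .nil => sameLevel_refl G _
  | _, _, .cons hadj w => (h _ _ hadj).trans hconn (sameLevel_of_walk hconn h w)

/-- **Nonunimodularity is visible on an edge** (the content of Lyons–Peres 2016, Exercise 8.6:
"if `Γ` acts transitively, then `Γ` is unimodular iff `|S(x)y| = |S(y)x|` for all edges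
`[x, y]`"; transitivity is not needed for this direction): on a connected, locally finite,
nonunimodular graph some vertex is above one of its neighbours — Timár's "`Δ` := the maximum of
`w(x)/w(y)`, where `x` and `y` are adjacent" exceeds `1` (2006, §5).
[cite: LyonsPeres2016, §8.2 (Exercise 8.6)] [cite: Timar2006, §5 (Δ > 1)] -/
theorem exists_adj_isAbove_of_not_isGraphUnimodular {G : SimpleGraph V} [G.LocallyFinite]
    (hconn : G.Connected) (hU : ¬ IsGraphUnimodular G) : ∃ x y : V, G.Adj x y ∧ IsAbove G x y := by
  by_contra hno
  push Not at hno
  have hedge : ∀ x y : V, G.Adj x y → SameLevel G x y := fun x y hxy =>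
    (sameLevel_or_isAbove_or_isAbove G x y).elim id fun h =>
      h.elim (fun h => absurd h (hno x y hxy)) fun h => absurd h (hno y x hxy.symm)
  obtain ⟨x, y, -, hxy⟩ := exists_isAbove_of_not_isGraphUnimodular hU
  exact hxy.not_sameLevel (sameLevel_of_walk hconn hedge (hconn.preconnected x y).some)

/-- On a connected, locally finite, **transitive** nonunimodular graph every vertex has a
neighbour below it. [cite: Timar2006, §2 (above/below; transitive nonunimodular graphs)] -/
theorem exists_neighbor_below {G : SimpleGraph V} [G.LocallyFinite] (hconn : G.Connected)
    (ht : IsGraphTransitive G) (hU : ¬ IsGraphUnimodular G) (x : V) :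
    ∃ y : V, G.Adj x y ∧ IsAbove G x y := by
  obtain ⟨a, b, hab, habove⟩ := exists_adj_isAbove_of_not_isGraphUnimodular hconn hU
  obtain ⟨γ, hγ⟩ := ht a x
  refine ⟨γ b, ?_, ?_⟩
  · rw [← hγ]; exact (γ.map_rel_iff').2 hab
  · rw [← hγ]; exact (isAbove_map_iff γ a b).2 habove

/-- On a connected, locally finite, **transitive** nonunimodular graph every vertex has a
neighbour above it. [cite: Timar2006, §2 (above/below; transitive nonunimodular graphs)] -/
theorem exists_neighbor_above {G : SimpleGraph V} [G.LocallyFinite] (hconn : G.Connected)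
    (ht : IsGraphTransitive G) (hU : ¬ IsGraphUnimodular G) (x : V) :
    ∃ y : V, G.Adj x y ∧ IsAbove G y x := by
  obtain ⟨a, b, hab, habove⟩ := exists_adj_isAbove_of_not_isGraphUnimodular hconn hU
  obtain ⟨γ, hγ⟩ := ht b x
  refine ⟨γ a, ?_, ?_⟩
  · rw [← hγ]; exact (γ.map_rel_iff').2 hab.symm
  · rw [← hγ]; exact (isAbove_map_iff γ a b).2 habove

/-- On a transitive **unimodular** graph all weights are `1` (connected, locally finite).
[cite: LyonsPeres2016, §8.2 ((8.4): unimodular transitive case)] -/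
theorem autWeight_eq_one_of_isGraphUnimodular {G : SimpleGraph V} [G.LocallyFinite]
    (hconn : G.Connected) (ht : IsGraphTransitive G) (hU : IsGraphUnimodular G) (o x : V) :
    autWeight G o x = 1 := by
  rw [← autWeight_self G hconn o]
  exact autWeight_eq_of_isGraphUnimodular G hconn hU o (ht x o)

/-! ### Lemma 2.2: the Mass-Transport Principle on nonunimodular transitive graphs -/

/-- **Timár 2006, Lemma 2.2 (the nonunimodular MTP), PROVED** — "Let `G` be a transitive
nonunimodular graph and `f(x, y)` a nonnegative function from `V(G) × V(G)` that is diagonally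
invariant under `Aut(G)`. Then `Σ_{y ∈ V(G)} f(x, y) = (1/w(x)) Σ_{y ∈ V(G)} f(y, x) w(y)` for every
vertex `x`." Here `G` is connected, locally finite and transitive (`IsGraphTransitive`, full
automorphism group), `f` is `[0, ∞]`-valued, sums are `tsum`s, `w = autWeight G o` for any base
vertex `o`; nonunimodularity is not used (for unimodular `G`, `w ≡ 1` and this is Lemma 2.1).
Proof: Lyons–Peres (8.10) with `u = w = x` and `Γx = V`.
[cite: Timar2006, Lemma 2.2] [cite: LyonsPeres2016, §8.2 ((8.10))] -/
theorem tsum_eq_inv_autWeight_mul_tsum (G : SimpleGraph V) [G.LocallyFinite] (hconn : G.Connected)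
    (ht : IsGraphTransitive G) {f : V → V → ℝ≥0∞}
    (hf : ∀ (γ : G ≃g G) (x y : V), f (γ x) (γ y) = f x y) (o x : V) :
    ∑' y, f x y = (autWeight G o x)⁻¹ * ∑' y, f y x * autWeight G o y := by
  have h := tsum_autOrbit_mul_autWeight_eq G hconn hf o x x
  rw [tsum_autOrbit_of_isGraphTransitive ht x (f x),
    tsum_autOrbit_of_isGraphTransitive ht x (fun y => f y x * autWeight G o y)] at h
  have hx0 := autWeight_ne_zero G hconn o x
  have hxT := autWeight_ne_top G hconn o x
  calc ∑' y, f x y = (autWeight G o x)⁻¹ * ((∑' y, f x y) * autWeight G o x) := by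
        rw [mul_comm (∑' y, f x y), ← mul_assoc, ENNReal.inv_mul_cancel hx0 hxT, one_mul]
    _ = (autWeight G o x)⁻¹ * ∑' y, f y x * autWeight G o y := by rw [h]

/-- Lemma 2.2 in multiplied-out form: `w(x) Σ_y f(x, y) = Σ_y f(y, x) w(y)`.
[cite: Timar2006, Lemma 2.2] [cite: LyonsPeres2016, §8.2 ((8.10))] -/
theorem autWeight_mul_tsum_eq (G : SimpleGraph V) [G.LocallyFinite] (hconn : G.Connected)
    (ht : IsGraphTransitive G) {f : V → V → ℝ≥0∞}
    (hf : ∀ (γ : G ≃g G) (x y : V), f (γ x) (γ y) = f x y) (o x : V) :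
    autWeight G o x * ∑' y, f x y = ∑' y, f y x * autWeight G o y := by
  rw [tsum_eq_inv_autWeight_mul_tsum G hconn ht hf o x, ← mul_assoc,
    ENNReal.mul_inv_cancel (autWeight_ne_zero G hconn o x) (autWeight_ne_top G hconn o x), one_mul]

section Random

open _root_.MeasureTheory

variable {Ω : Type*} [MeasurableSpace Ω]

/-- **Lemma 2.2 for invariant random transports** ("We shall typically define a function `φ` on
`V(G) × V(G) × 2^G` with `φ(x, y; ω) = φ(γx, γy; γω)` for every `γ ∈ Aut(G)` … We refer to this
by saying '`x` sends mass `φ(x, y; ω)` to `y` when `ω`' … Then `f(x, y)` is defined as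
`E[φ(x, y; ω)]`", Timár 2006, §2, with Lemma 2.2): for a measure `μ` on `Ω` preserved by
measurable maps `act γ` (`γ ∈ Aut(G)`) and a measurable `φ(x, y; ω) ∈ [0, ∞]` with
`φ(γx, γy; γω) = φ(x, y; ω)`, on a connected, locally finite, transitive graph,
`E[Σ_y φ(x, y; ω)] = w(x)⁻¹ E[Σ_y φ(y, x; ω) w(y)]`.
[cite: Timar2006, Lemma 2.2 (and the paragraph following Lemma 2.1)]
[cite: LyonsPeres2016, §8.1 (p. 389, f(x,y) := E F(x,y;ω))] -/
theorem lintegral_tsum_eq_inv_autWeight_mul (G : SimpleGraph V) [G.LocallyFinite]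
    (hconn : G.Connected) (ht : IsGraphTransitive G) (μ : Measure Ω) (act : (G ≃g G) → Ω → Ω)
    (hact : ∀ γ, Measurable (act γ)) (hμ : ∀ γ, μ.map (act γ) = μ) {φ : V → V → Ω → ℝ≥0∞}
    (hφ : ∀ x y, Measurable (φ x y))
    (hinv : ∀ (γ : G ≃g G) (x y : V) (ω : Ω), φ (γ x) (γ y) (act γ ω) = φ x y ω) (o x : V) :
    ∫⁻ ω, ∑' y, φ x y ω ∂μ = (autWeight G o x)⁻¹ * ∫⁻ ω, ∑' y, φ y x ω * autWeight G o y ∂μ := by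
  haveI : Countable V := countable_of_connected_of_locallyFinite G hconn o
  rw [lintegral_tsum fun y => (hφ x y).aemeasurable,
    lintegral_tsum fun y => ((hφ y x).mul_const _).aemeasurable]
  rw [tsum_eq_inv_autWeight_mul_tsum G hconn ht (f := fun x y => ∫⁻ ω, φ x y ω ∂μ)
    (fun γ x y => lintegral_diagInvariant μ act hact hμ hφ hinv γ x y) o x]
  congr 1
  refine tsum_congr fun y => ?_
  rw [lintegral_mul_const _ (hφ y x)]

end Random

/-! ### Heavy and light vertex sets (clusters) -/

/-- The **total weight** `Σ_{v ∈ C} w(v)` of a vertex set, weights based at `o`.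
[cite: Timar2006, §2 (heavy and light clusters)] -/
def setWeight (G : SimpleGraph V) (o : V) (C : Set V) : ℝ≥0∞ :=
  ∑' v, C.indicator (autWeight G o) v

/-- A vertex set (in Timár's usage, a percolation cluster) is **heavy** if the sum of the
weights over its vertices is infinite; otherwise it is **light** (Timár 2006, §2: "We call a
cluster *heavy* if the sum of weights over its vertices is infinite. Otherwise, we call the
cluster *light*"). Weights based at `o`; the notion does not depend on `o`
(`isHeavy_iff_of_base`). [cite: Timar2006, §1 and §2 (heavy and light clusters)] -/
def IsHeavy (G : SimpleGraph V) (o : V) (C : Set V) : Prop :=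
  setWeight G o C = ⊤

/-- Changing the base vertex rescales the total weight: `W_y(C) · w_o(y) = W_o(C)`.
[cite: Timar2006, §2 (weights determined modulo a constant factor)] -/
theorem setWeight_base_mul (G : SimpleGraph V) [G.LocallyFinite] (hconn : G.Connected)
    (o y : V) (C : Set V) : setWeight G y C * autWeight G o y = setWeight G o C := by
  rw [setWeight, setWeight, ← ENNReal.tsum_mul_right]
  refine tsum_congr fun v => ?_
  by_cases hv : v ∈ C
  · rw [Set.indicator_of_mem hv, Set.indicator_of_mem hv, autWeight_base_mul G hconn o y v]
  · rw [Set.indicator_of_notMem hv, Set.indicator_of_notMem hv, zero_mul]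

/-- **Heaviness does not depend on the base vertex** (the weights change by a constant factor in
`(0, ∞)`). [cite: Timar2006, §2 (weights determined modulo a constant factor)] -/
theorem isHeavy_iff_of_base (G : SimpleGraph V) [G.LocallyFinite] (hconn : G.Connected)
    (o y : V) (C : Set V) : IsHeavy G y C ↔ IsHeavy G o C := by
  rw [IsHeavy, IsHeavy, ← setWeight_base_mul G hconn o y C]
  constructor
  · intro h
    rw [h, ENNReal.top_mul (autWeight_ne_zero G hconn o y)]
  · intro h
    by_contra hne
    exact ENNReal.mul_ne_top hne (autWeight_ne_top G hconn o y) h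

/-- A finite vertex set is light. [folklore] -/
theorem not_isHeavy_of_finite (G : SimpleGraph V) [G.LocallyFinite] (hconn : G.Connected) (o : V)
    {C : Set V} (hC : C.Finite) : ¬ IsHeavy G o C := by
  rw [IsHeavy, setWeight, ← tsum_subtype C (autWeight G o)]
  haveI : Finite C := hC.to_subtype
  haveI : Fintype C := Fintype.ofFinite C
  rw [tsum_fintype]
  exact ENNReal.sum_ne_top.2 fun v _ => autWeight_ne_top G hconn o v

/-- A heavy set is infinite. [folklore] -/
theorem IsHeavy.infinite {G : SimpleGraph V} [G.LocallyFinite] (hconn : G.Connected) {o : V}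
    {C : Set V} (h : IsHeavy G o C) : C.Infinite :=
  fun hC => not_isHeavy_of_finite G hconn o hC h

/-- The total weight dominates `a · #{v ∈ C : a ≤ w(v)}`. [folklore] -/
theorem mul_encard_le_setWeight (G : SimpleGraph V) (o : V) (C : Set V) (a : ℝ≥0∞) :
    a * ((C ∩ {v | a ≤ autWeight G o v}).encard : ℝ≥0∞) ≤ setWeight G o C := by
  rw [mul_comm, ← tsum_indicator_const, setWeight]
  refine ENNReal.tsum_le_tsum fun v => ?_
  by_cases hv : v ∈ C ∩ {v | a ≤ autWeight G o v}
  · rw [Set.indicator_of_mem hv, Set.indicator_of_mem hv.1]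
    exact hv.2
  · rw [Set.indicator_of_notMem hv]
    exact zero_le

/-- **A light set has only finitely many vertices above any weight threshold** (for `a > 0`,
`{v ∈ C : w(v) ≥ a}` is finite) — the fact behind "the intersection of a light cluster with
`G(ℓ_{j+i}, ℓ_j]` is finite by definition" (Timár 2006, §4, p. 2353) and "by lightness … the
cluster would be bounded from below" arguments. [cite: Timar2006, §4 (proof of Thm. 4.3: light clusters meet bounded level ranges finitely)] -/
theorem finite_inter_of_not_isHeavy {G : SimpleGraph V} {o : V} {C : Set V} (h : ¬ IsHeavy G o C)
    {a : ℝ≥0∞} (ha : a ≠ 0) : (C ∩ {v | a ≤ autWeight G o v}).Finite := by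
  by_contra hinf
  apply h
  rw [IsHeavy, eq_top_iff]
  calc (⊤ : ℝ≥0∞) = a * ((C ∩ {v | a ≤ autWeight G o v}).encard : ℝ≥0∞) := by
        rw [Set.encard_eq_top_iff.2 hinf, ENat.toENNReal_top, ENNReal.mul_top ha]
    _ ≤ setWeight G o C := mul_encard_le_setWeight G o C a

/-- In particular a light set meets every level in a finite set (weights are constant and
positive on a level). [cite: Timar2006, §4 (light clusters meet levels finitely)] -/
theorem finite_inter_level_of_not_isHeavy {G : SimpleGraph V} [G.LocallyFinite]
    (hconn : G.Connected) {o : V} {C : Set V} (h : ¬ IsHeavy G o C) (x : V) :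
    (C ∩ level G x).Finite := by
  refine (finite_inter_of_not_isHeavy h (autWeight_ne_zero G hconn o x)).subset ?_
  rintro v ⟨hvC, hv⟩
  refine ⟨hvC, ?_⟩
  show autWeight G o x ≤ autWeight G o v
  rw [(sameLevel_iff_autWeight_eq G hconn o x v).1 hv]

/-- On a transitive unimodular graph the total weight of a set is its cardinality.
[cite: LyonsPeres2016, §8.2 ((8.4): unimodular transitive case)] -/
theorem setWeight_eq_encard_of_isGraphUnimodular {G : SimpleGraph V} [G.LocallyFinite]
    (hconn : G.Connected) (ht : IsGraphTransitive G) (hU : IsGraphUnimodular G) (o : V)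
    (C : Set V) : setWeight G o C = (C.encard : ℝ≥0∞) := by
  rw [setWeight, ← mul_one (C.encard : ℝ≥0∞), ← tsum_indicator_const]
  refine tsum_congr fun v => ?_
  by_cases hv : v ∈ C
  · rw [Set.indicator_of_mem hv, Set.indicator_of_mem hv,
      autWeight_eq_one_of_isGraphUnimodular hconn ht hU o v]
  · rw [Set.indicator_of_notMem hv, Set.indicator_of_notMem hv]

/-- **On a transitive unimodular graph, heavy = infinite** (all weights are `1`), so that Timár's
heavy/light distinction is a genuinely nonunimodular phenomenon.
[cite: Timar2006, §1 (heavy clusters; unimodular comparison)] [cite: LyonsPeres2016, §8.2 ((8.4))] -/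
theorem isHeavy_iff_infinite_of_isGraphUnimodular {G : SimpleGraph V} [G.LocallyFinite]
    (hconn : G.Connected) (ht : IsGraphTransitive G) (hU : IsGraphUnimodular G) (o : V)
    (C : Set V) : IsHeavy G o C ↔ C.Infinite := by
  rw [IsHeavy, setWeight_eq_encard_of_isGraphUnimodular hconn ht hU o C, ENat.toENNReal_eq_top,
    Set.encard_eq_top_iff]

end Literature.Barriers.CriticalPhenomena

end
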